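import Literature.NumberTheory.GaloisRepresentations.PstCrystallineExtensionData
import Literature.NumberTheory.GaloisRepresentations.FramedGaloisRepInduce
import Literature.NumberTheory.GaloisRepresentations.FramedRepTwist
import Literature.NumberTheory.GaloisRepresentations.LocalGaloisGroup
import Literature.NumberTheory.PAdicHodge.FontaineDpst
import HarnessLib

/-!
# Permanence of potential diagonalizability under finite restriction, crystalline twist and
# induction, for THE pinned data (Barnet-Lamb–Gee–Geraghty–Taylor 2014, §1.4 — three named schemata)

Topic `NumberTheory/GaloisRepresentations`; story of the accepted `PotentialDiagonalizability`
(`IsPotentiallyDiagonalizable`, `ConnectsOver`, BLGGT §1.4) and `PstCrystallineExtensionData`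
(compatible crystalline extension data `𝔈` over a `p`-adic Hodge datum; intended instance Fontaine's
tower `K' ↦ B_cris(K')`).  Three NAMED FACTS (D-0014, `def X : Prop`, cited), each the tree form —
for Fontaine's PINNED data `fontainePstAdicCompletion v ℓ hv` of the summit `Langlands` and for EVERY
instance `𝔈` of compatible crystalline extension data over it, exactly as the local clause (3) of
the accepted `BLGGT2014_thmC_potentialAutomorphy` / `BLGGT2014_thm421_GL2_totallyReal` is phrased — of
the permanence properties of potential diagonalizability listed in BLGGT §1.4 (held text
arXiv:1010.2561 pp. 13–15, read 2026-08-17):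

* `PDRestrictSchema` — restriction to a finite extension: VERBATIM in print, "Note that if `K''/K` is
  a finite extension and `ρ` is diagonalizable (resp. potentially diagonalizable) then `ρ|_{G_{K''}}`
  is diagonalizable (resp. potentially diagonalizable)" (p. 14), transported from `Γ_{F_v} ⊇ Γ_{E_w}`
  to the tree's `(ρ|_{Γ_E})|_{Γ_{E_w}}` by the change of frame of the accepted
  `exists_toLocal_restrictField_eq_conj` and Lemma 1.4.1 (conjugation invariance, proved in the tree as
  `isPotentiallyDiagonalizable_conj_iff`).
* `PDTwistSchema` — twist by a character which is a power of the cyclotomic character on inertia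
  (hence `ε^k ·` unramified on `Γ_{E_w}`: a crystalline character): from the printed bullets "If
  `ρ₁ ∼ ρ₂` and `ρ₁' ∼ ρ₂'` then … `ρ₁ ⊗ ρ₁' ∼ ρ₂ ⊗ ρ₂'`" and "If `K'/K` is a finite extension and
  `ρ₁ ∼ ρ₂` then `ρ₁|_{G_{K'}} ∼ ρ₂|_{G_{K'}}`" (p. 14): `ρ|_{K'} ∼ χ₁ ⊕ ⋯ ⊕ χ_n` gives
  `(ρ ⊗ χ)|_{K'} ∼ χ₁χ ⊕ ⋯ ⊕ χ_nχ`, a crystalline sum of crystalline characters.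
* `PDInduceSchema` — induction along a finite extension `E/K` of number fields: by Mackey,
  `(Ind_{Γ_E}^{Γ_K} W)|_{Γ_{K_v}} ≅ ⊕_{w ∣ v} Ind_{E_w}^{K_v}(W|_{Γ_{E_w}})`, and after restriction to
  a finite Galois `M/K_v` containing the images of the `E_w` each summand is a direct sum of
  conjugates of restrictions of the `W|_{Γ_{E_w}}`; potential diagonalizability is insensitive to
  finite restriction in both directions ("potentially", p. 14, and the quoted Note), is preserved by
  direct sums (the `⊕` bullet) and by transport along isomorphisms of local fields.  In print this is
  how inductions are shown potentially diagonalizable: BLGGT p. 25, "`(Ind_{G_M}^{G_F} θ)|_{G_K} ∼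
  φ₁^{(u)}|_{G_K} ⊕ ⋯ ⊕ φ_n^{(u)}|_{G_K}`"; Emerton–Gee 2022, proof of Thm. 6.4.4, "`ρ° :=
  Ind_{G_{K'}}^{G_K} ψ` … is potentially diagonalizable, because `ρ°|_{G_{K'}}` is a direct sum of
  crystalline characters".

Like the accepted `DeRhamBaseChange` / `LabelledWeightsRestrictSchema`, these relate the pinned data
(and here, in addition, arbitrary instances `𝔈` of the extension-data interface) of DIFFERENT local
fields, and are therefore recorded as named facts rather than derived.  Wanted by the crux
`stmt-Langlands-17000` (`NonParallelVoid.TwistedInductionParallel`, line `symmetrise-pd-split`, stub 3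
`stub_potentialAutomorphyOfInducedTwist`: the potential-diagonalizability clause of BLGGT Thm. C for
`Ind_E^K(ρ|_E ⊗ χ)` from the crux hypothesis `PDAbove` on `ρ`).

## References

* [BarnetlambEtAl2014] T. Barnet-Lamb, T. Gee, D. Geraghty, R. Taylor, *Potential automorphy and
  change of weight*, Ann. of Math. 179 (2014) 501–609: §1.4 (pp. 13–15 of arXiv:1010.2561; the seven
  bullets on `∼`, the definitions of (potentially) diagonalizable, the Note, Lemma 1.4.1), §4.3 p. 25.
* [EmertonGee2022] M. Emerton, T. Gee, *Moduli stacks of étale (φ, Γ)-modules and the existence of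
  crystalline lifts*, Ann. of Math. Stud. 215 (2023), Def. 6.4.2, Lemma 6.4.3, proof of Thm. 6.4.4.
* [SerreAbelianLadic1968] J.-P. Serre, *Abelian ℓ-adic representations and elliptic curves* (1968),
  Ch. I §2.3.

`lean search 'PDRestrictSchema|PDTwistSchema|PDInduceSchema|isPotentiallyDiagonalizable_induce|isPotentiallyDiagonalizable_twist'`
(2026-08-17): no prior declaration; nearest proved neighbours `isPotentiallyDiagonalizable_conj_iff`,
`IsDiagonalizableOver.isPotentiallyDiagonalizable`, `isPotentiallyDiagonalizable_one`,
`PstCrystallineExtensionData.isPotentiallyDiagonalizable_of_weightsInRange_of_surjective`.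
-/

noncomputable section

open scoped NumberField
open NumberField IsDedekindDomain Field Filter
open Literature.NumberTheory.PAdicHodge

namespace Literature.NumberTheory.GaloisRepresentations

/-- **Potential diagonalizability restricts to finite extensions, place by place, for THE pinned
data and every instance of compatible crystalline extension data** (BLGGT §1.4, p. 14: "Note that if
`K''/K` is a finite extension and `ρ` is … potentially diagonalizable then `ρ|_{G_{K''}}` is …
potentially diagonalizable"; with the change of frame `exists_toLocal_restrictField_eq_conj` and
Lemma 1.4.1): for number fields `F ⊆ E`, a framed `ρ : Γ_F → GL_n(ℚ̄_ℓ)`, places `w ∣ v ∣ ℓ`, if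
`ρ|_{Γ_{F_v}}` is potentially diagonalizable for every `𝔈` over `fontainePstAdicCompletion v ℓ hv`
then `(ρ|_{Γ_E})|_{Γ_{E_w}}` is potentially diagonalizable for every `𝔈` over
`fontainePstAdicCompletion w ℓ hw`.
[cite: BarnetlambEtAl2014, §1.4 (p. 14, Note after the definition; Lemma 1.4.1)] -/
def PDRestrictSchema : Prop :=
  ∀ (F E : Type) [Field F] [NumberField F] [Field E] [NumberField E] [Algebra F E] (ℓ : ℕ)
    [Fact ℓ.Prime] (n : ℕ) (ρ : FramedGaloisRep F (PadicAlgCl ℓ) n)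
    (v : HeightOneSpectrum (𝓞 F)) (hv : ((ℓ : ℕ) : 𝓞 F) ∈ v.asIdeal)
    (w : HeightOneSpectrum (𝓞 E)) (hw : ((ℓ : ℕ) : 𝓞 E) ∈ w.asIdeal),
    w.asIdeal.under (𝓞 F) = v.asIdeal →
    (∀ 𝔈 : PstCrystallineExtensionData (fontainePstAdicCompletion v ℓ hv),
      letI := (fontainePstAdicCompletion v ℓ hv).algebra
      IsPotentiallyDiagonalizable 𝔈.𝔅 (ρ.toLocal v)) →
    ∀ 𝔈 : PstCrystallineExtensionData (fontainePstAdicCompletion w ℓ hw),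
      letI := (fontainePstAdicCompletion w ℓ hw).algebra
      IsPotentiallyDiagonalizable 𝔈.𝔅 ((ρ.restrictField E).toLocal w)

/-- **Potential diagonalizability is preserved by twisting with a character which is a power of the
cyclotomic character on inertia, for THE pinned data and every instance of compatible crystalline
extension data** (BLGGT §1.4, p. 14, bullets "`ρ₁ ⊗ ρ₁' ∼ ρ₂ ⊗ ρ₂'`" and "`ρ₁|_{G_{K'}} ∼ ρ₂|_{G_{K'}}`":
`ρ|_{K'} ∼ ⊕ χ_i` gives `(ρ ⊗ χ)|_{K'} ∼ ⊕ χ_iχ`, and `χ|_{Γ_{E_w}} = ε^k · (unramified)` is a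
crystalline character): for a number field `E`, a framed `W : Γ_E → GL_n(ℚ̄_ℓ)`, a continuous
`χ : Γ_E → ℚ̄_ℓˣ` and a place `w ∣ ℓ` such that `χ = ε^k` on the inertia group of `E_w` for some
`k : ℤ`, if `W|_{Γ_{E_w}}` is potentially diagonalizable for every `𝔈` then so is `(W ⊗ χ)|_{Γ_{E_w}}`.
[cite: BarnetlambEtAl2014, §1.4 (p. 14, bullets 4–5)] -/
def PDTwistSchema : Prop :=
  ∀ (E : Type) [Field E] [NumberField E] (ℓ : ℕ) [Fact ℓ.Prime] (n : ℕ)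
    (W : FramedGaloisRep E (PadicAlgCl ℓ) n) (χ : absoluteGaloisGroup E →ₜ* (PadicAlgCl ℓ)ˣ)
    (w : HeightOneSpectrum (𝓞 E)) (hw : ((ℓ : ℕ) : 𝓞 E) ∈ w.asIdeal),
    (∃ k : ℤ, ∀ σ : absoluteGaloisGroup (w.adicCompletion E), σ ∈ absInertia (w.adicCompletion E) →
      ((χ (absGaloisRestrict E (w.adicCompletion E) σ) : (PadicAlgCl ℓ)ˣ) : PadicAlgCl ℓ) =
        (algebraMap ℚ_[ℓ] (PadicAlgCl ℓ)
          ((GaloisRep.cyclotomicCharacter (w.adicCompletion E) ℓ σ : ℤ_[ℓ]ˣ) : ℤ_[ℓ])) ^ k) →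
    (∀ 𝔈 : PstCrystallineExtensionData (fontainePstAdicCompletion w ℓ hw),
      letI := (fontainePstAdicCompletion w ℓ hw).algebra
      IsPotentiallyDiagonalizable 𝔈.𝔅 (W.toLocal w)) →
    ∀ 𝔈 : PstCrystallineExtensionData (fontainePstAdicCompletion w ℓ hw),
      letI := (fontainePstAdicCompletion w ℓ hw).algebra
      IsPotentiallyDiagonalizable 𝔈.𝔅 (FramedGaloisRep.toLocal w (FramedRep.twist W χ))

/-- **Potential diagonalizability is preserved by induction along a finite extension of number
fields, for THE pinned data and every instance of compatible crystalline extension data** (BLGGT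
§1.4: Mackey `(Ind_{Γ_E}^{Γ_K} W)|_{Γ_{K_v}} ≅ ⊕_{w ∣ v} Ind_{E_w}^{K_v}(W|_{Γ_{E_w}})`; after a finite
Galois `M/K_v` each summand is a direct sum of conjugates of restrictions of the `W|_{Γ_{E_w}}`;
"potentially" and the Note p. 14 (finite restriction both ways), the `⊕` bullet, transport of
structure along isomorphisms of local fields; used so in print for inductions of characters, BLGGT
p. 25 and Emerton–Gee, proof of Thm. 6.4.4): for number fields `K ⊆ E` with `[E : K] = d` and a
framed `W : Γ_E → GL_n(ℚ̄_ℓ)`, if `W|_{Γ_{E_w}}` is potentially diagonalizable for every place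
`w ∣ ℓ` of `E` and every `𝔈` over `fontainePstAdicCompletion w ℓ hw`, then
`(Ind_{Γ_E}^{Γ_K} W)|_{Γ_{K_v}}` (`FramedGaloisRep.induce`) is potentially diagonalizable for every
place `v ∣ ℓ` of `K` and every `𝔈` over `fontainePstAdicCompletion v ℓ hv`.
[cite: BarnetlambEtAl2014, §1.4 (pp. 13–15) and §4.3 p. 25]
[cite: EmertonGee2022, proof of Thm. 6.4.4 (with Def. 6.4.2, Lemma 6.4.3)]
[cite: SerreAbelianLadic1968, Ch. I §2.3] -/
def PDInduceSchema : Prop :=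
  ∀ (K E : Type) [Field K] [NumberField K] [Field E] [NumberField E] [Algebra K E] (d : ℕ)
    (hd : Module.finrank K E = d) (ℓ : ℕ) [Fact ℓ.Prime] (n : ℕ)
    (W : FramedGaloisRep E (PadicAlgCl ℓ) n),
    (∀ (w : HeightOneSpectrum (𝓞 E)) (hw : ((ℓ : ℕ) : 𝓞 E) ∈ w.asIdeal)
      (𝔈 : PstCrystallineExtensionData (fontainePstAdicCompletion w ℓ hw)),
      letI := (fontainePstAdicCompletion w ℓ hw).algebra
      IsPotentiallyDiagonalizable 𝔈.𝔅 (W.toLocal w)) →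
    ∀ (v : HeightOneSpectrum (𝓞 K)) (hv : ((ℓ : ℕ) : 𝓞 K) ∈ v.asIdeal)
      (𝔈 : PstCrystallineExtensionData (fontainePstAdicCompletion v ℓ hv)),
      letI := (fontainePstAdicCompletion v ℓ hv).algebra
      IsPotentiallyDiagonalizable 𝔈.𝔅 ((W.induce K hd).toLocal v)

end Literature.NumberTheory.GaloisRepresentations

end
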